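import Summits.BirchSwinnertonDyer.BirchSwinnertonDyer.Theorems.SignedLowerHalvesSmallImageLowerHalfBothSignsRttD2SeqSemilocNakayama
import Summits.BirchSwinnertonDyer.BirchSwinnertonDyer.Theorems.SignedLowerHalvesSmallImageLowerHalfBothSignsRttD2SeqJ3TracePairing
import HarnessLib

/-!
# Route `SignedLowerHalves`, crux L `SmallImageLowerHalfBothSigns` (stmt-BirchSwinnertonDyer-23599), line `rtt_w3` v30 — stub S3β″ (`stub_junctionPT_ns`), input N5-(i), part 3a:
# THE INCLUSION `Lloc_w(n,k) → Lloc_w(n,k+1)` OF THE SEMILOCAL LEVELS (`𝒪 ⊗ μ_{p^k} ↪ 𝒪 ⊗ μ_{p^{k+1}}`), ITS NATURALITY, AND (E2) `p = incl ∘ red`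

WIDTH seat `bsd-line-slh-p3-w3` g26 under LEAD `cruxlead-stmt-BirchSwinnertonDyer-23599` g14 (cell `bsd-ssimc`); helper `--supports stmt-BirchSwinnertonDyer-23599`. DEFINITIONS WITH BODIES
(`oMuIncl`, `semilocIncl`) + THEOREMS; no named fact, no instance, no `sorry`. HONEST FRAMING: discharges, for -w3's semilocal levels `Lloc_w(n,k) = H^i(Γ_{K_w}, Maps(Γ_K ⧸ U_n, X_k))`
(T1-a/T1-b₁), the «incl» datum `ι` of part 2 (`…RttD2SeqSemilocNakayama`, p817289) together with its two naturalities (`hιc`, `hιr`) and hypothesis (E2) `p • z = ι (red z)`; the exactness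
(E1) and the bound (B) remain (parts 3b/3c). Nothing about S3β″, crux L or BSD is proved; all remain OPEN and are proved for NO curve.

* §1 `oMuIncl S k : 𝒪 ⊗ μ_{p^k} → 𝒪 ⊗ μ_{p^{k+1}}` (`id ⊗ (μ_{p^k} ⊆ μ_{p^{k+1}})`), `oMuIncl_tmul`, `oMuIncl_muTwistO` (equivariance), ★ `oMuRed_oMuIncl_succ` (`red ∘ incl = incl ∘ red` one level up),
  ★ `oMuIncl_oMuRed` (`incl ∘ red = p ⊗ id = oMuScalar p`).
* §2 `semilocIncl` (`H^i(res_w, Maps(incl))`), `semilocCores_semilocIncl`, `semilocRed_semilocIncl`, `semilocScalar_natCast`, ★★ `nsmul_eq_semilocIncl_semilocRed` ((E2): `p • z = incl (red z)`).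
References: [NeukirchSchmidtWingberg2008] (7.1.4), (7.2.6), I §5; [Kato2004Asterisque] §8.2 (p. 180); [JohnsonLeungKings2011] §4.1–4.2.
-/

set_option autoImplicit false
set_option linter.dupNamespace false -- D-0017: single-problem summit, the namespace repeats the problem name by design
noncomputable section

open scoped Classical TensorProduct
open NumberField IsDedekindDomain Field CategoryTheory

namespace Summit.BirchSwinnertonDyer.BirchSwinnertonDyer.Theorems.SmallImageRttD2Seq

open Literature.NumberTheory.EllipticCurves Literature.NumberTheory.GaloisRepresentations Literature.NumberTheory.GaloisRepresentations.DiscreteGaloisModule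
  Literature.NumberTheory.ComplexMultiplication.EllipticUnits.JohnsonLeungKings2011
  Summit.BirchSwinnertonDyer.BirchSwinnertonDyer.Theorems.SmallImageRttD2J1

/-! ## §1. The inclusion on carriers -/

section Carrier

variable {K : Type} [Field K] [NumberField K] {p : ℕ} [Fact p.Prime] (S : Set (PadicAlgCl p)) (θ' : absoluteGaloisGroup K →ₜ* (padicCoeffIntegers S)ˣ)

/-- **The inclusion `𝒪 ⊗ μ_{p^k} → 𝒪 ⊗ μ_{p^{k+1}}`, `a ⊗ ζ ↦ a ⊗ ζ`** (`id ⊗` the tree's `muInclusion`); under `𝒪 ⊗ μ_{p^k} ≅ 𝒪/p^k` it is multiplication by `p`.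
[cite: NeukirchSchmidtWingberg2008, (7.1.4)] [cite: Kato2004Asterisque, §8.2 (p. 180)] -/
def oMuIncl (k : ℕ) : OMuCarrier K S (p ^ k) →+ OMuCarrier K S (p ^ (k + 1)) :=
  (TensorProduct.map (LinearMap.id : padicCoeffIntegers S →ₗ[ℤ] padicCoeffIntegers S)
    (muInclusion K (pow_dvd_pow p (Nat.le_succ k))).toIntLinearMap).toAddMonoidHom

omit [NumberField K] in
/-- The inclusion on pure tensors. [folklore] -/
@[simp] theorem oMuIncl_tmul (k : ℕ) (a : padicCoeffIntegers S) (v : MuCarrier K (p ^ k)) :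
    oMuIncl S k (OMuCarrier.tmul (K := K) a v) = OMuCarrier.tmul a (muInclusion K (pow_dvd_pow p (Nat.le_succ k)) v) :=
  rfl

omit [NumberField K] [Fact p.Prime] in
/-- `μ_{p^k} ⊆ μ_{p^{k+1}}` is `Γ_K`-equivariant. [folklore] -/
theorem muInclusion_mu_succ (k : ℕ) (σ : absoluteGaloisGroup K) (v : MuCarrier K (p ^ k)) :
    muInclusion K (pow_dvd_pow p (Nat.le_succ k)) (mu K (p ^ k) σ v) = mu K (p ^ (k + 1)) σ (muInclusion K (pow_dvd_pow p (Nat.le_succ k)) v) := by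
  apply muVal_injective K (p ^ (k + 1))
  rw [muVal_muInclusion, muVal_apply, muVal_apply, muVal_muInclusion]

omit [NumberField K] in
/-- **The inclusion `𝒪 ⊗ μ_{p^k} ⊗ θ′ → 𝒪 ⊗ μ_{p^{k+1}} ⊗ θ′` is `Γ_K`-equivariant.** [cite: NeukirchSchmidtWingberg2008, (7.2.6)] -/
theorem oMuIncl_muTwistO (k : ℕ) (σ : absoluteGaloisGroup K) (x : OMuCarrier K S (p ^ k)) :
    oMuIncl S k (muTwistO S θ' k σ x) = muTwistO S θ' (k + 1) σ (oMuIncl S k x) := by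
  induction x using OMuCarrier.induction_on with
  | zero => simp
  | tmul a v => rw [muTwistO_tmul, oMuIncl_tmul, oMuIncl_tmul, muTwistO_tmul, muInclusion_mu_succ]
  | add x y hx hy => rw [map_add, map_add, hx, hy, map_add, map_add]

omit [NumberField K] in
/-- `(ζ : μ_{p^{k+2}})^p = ζ^p ∈ μ_{p^{k+1}}` for `ζ ∈ μ_{p^{k+1}}`: power map and inclusion commute. [folklore] -/
theorem muPowMap_muInclusion_succ (k : ℕ) (v : MuCarrier K (p ^ (k + 1))) :
    muPowMap K (pow_dvd_pow p (Nat.le_succ (k + 1))) (muInclusion K (pow_dvd_pow p (Nat.le_succ (k + 1))) v) =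
      muInclusion K (pow_dvd_pow p (Nat.le_succ k)) (muPowMap K (pow_dvd_pow p (Nat.le_succ k)) v) := by
  apply muVal_injective K (p ^ (k + 1))
  have h1 : p ^ (k + 2) / p ^ (k + 1) = p := by rw [pow_succ, Nat.mul_div_cancel_left _ (pow_pos (Fact.out : p.Prime).pos _)]
  have h2 : p ^ (k + 1) / p ^ k = p := by rw [pow_succ, Nat.mul_div_cancel_left _ (pow_pos (Fact.out : p.Prime).pos _)]
  rw [muVal_muPowMap, muVal_muInclusion, muVal_muInclusion, muVal_muPowMap, h1, h2]

omit [NumberField K] in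
/-- ★ **`red ∘ incl = incl ∘ red`** on `𝒪 ⊗ μ_{p^{k+1}}` (both are `a ⊗ ζ ↦ a ⊗ ζ^p` read in `μ_{p^{k+1}}`). [cite: Kato2004Asterisque, §8.2 (p. 180)] -/
theorem oMuRed_oMuIncl_succ (k : ℕ) (x : OMuCarrier K S (p ^ (k + 1))) : oMuRed S (k + 1) (oMuIncl S (k + 1) x) = oMuIncl S k (oMuRed S k x) := by
  induction x using OMuCarrier.induction_on with
  | zero => simp
  | tmul a v => rw [oMuIncl_tmul, oMuRed_tmul, oMuRed_tmul, oMuIncl_tmul, muPowMap_muInclusion_succ]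
  | add x y hx hy => rw [map_add, map_add, hx, hy, map_add, map_add]

omit [NumberField K] in
/-- ★ **`incl ∘ red = p ⊗ id`** on `𝒪 ⊗ μ_{p^{k+1}}` (`ζ ↦ ζ^p ↦ ζ^p = p·ζ`; `a ⊗ p·ζ = pa ⊗ ζ`). [cite: NeukirchSchmidtWingberg2008, (7.1.4)] -/
theorem oMuIncl_oMuRed (k : ℕ) (x : OMuCarrier K S (p ^ (k + 1))) : oMuIncl S k (oMuRed S k x) = oMuScalar S (p ^ (k + 1)) (p : padicCoeffIntegers S) x := by
  induction x using OMuCarrier.induction_on with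
  | zero => simp
  | tmul a v =>
    have htz : ∀ (b : padicCoeffIntegers S) (m : ℤ) (u : MuCarrier K (p ^ (k + 1))), OMuCarrier.tmul (K := K) b (m • u) = OMuCarrier.tmul (m • b) u := fun b m u ↦ by
      change OMuCarrier.toTensor.symm (b ⊗ₜ[ℤ] (m • u)) = OMuCarrier.toTensor.symm ((m • b) ⊗ₜ[ℤ] u)
      rw [TensorProduct.smul_tmul]
    rw [oMuRed_tmul, oMuIncl_tmul, muInclusion_muPowMap, oMuScalar_tmul, ← natCast_zsmul, htz, zsmul_eq_mul, Int.cast_natCast]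
  | add x y hx hy => rw [map_add, map_add, hx, hy, map_add]

end Carrier

/-! ## §2. The inclusion on the semilocal levels, its naturality, and (E2) -/

section Levels

variable {K : Type} [Field K] [NumberField K] {p : ℕ} [Fact p.Prime] (S : Set (PadicAlgCl p)) (κ : ZpExtension K p)
  (θ' : absoluteGaloisGroup K →ₜ* (padicCoeffIntegers S)ˣ) (P : Set (HeightOneSpectrum (𝓞 K))) (w : HeightOneSpectrum (𝓞 K))

/-- **The inclusion `Lloc_w(n,k) → Lloc_w(n,k+1)`** (`H^i(res_w, Maps(id ⊗ (μ_{p^k} ⊆ μ_{p^{k+1}})))`) — the «incl» datum `ι` of `…RttD2SeqSemilocNakayama`.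
[cite: NeukirchSchmidtWingberg2008, (7.1.4), I §5] [cite: Kato2004Asterisque, §8.2 (p. 180)] -/
def semilocIncl (n k i : ℕ) : semilocCoh S κ θ' P w n k i →+ semilocCoh S κ θ' P w n (k + 1) i :=
  semilocCoeff S κ θ' P w n (oMuIncl S k) (oMuIncl_muTwistO S θ' k) i

/-- **`cores ∘ incl = incl ∘ cores`** (T1-b₁ `semilocCores_semilocCoeff`). [cite: NeukirchSchmidtWingberg2008, I §5 Prop. 1.5.2] -/
theorem semilocCores_semilocIncl (n k i : ℕ) (y : semilocCoh S κ θ' P w (n + 1) k i) :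
    semilocCores S κ θ' P w n (k + 1) i (semilocIncl S κ θ' P w (n + 1) k i y) = semilocIncl S κ θ' P w n k i (semilocCores S κ θ' P w n k i y) :=
  semilocCores_semilocCoeff S κ θ' P w n _ _ i y

/-- **`red ∘ incl = incl ∘ red`** on the levels (both are `H^i(res_w, Maps(a ⊗ ζ ↦ a ⊗ ζ^p))`). [cite: Kato2004Asterisque, §8.2 (p. 180)] -/
theorem semilocRed_semilocIncl (n k i : ℕ) (y : semilocCoh S κ θ' P w n (k + 1) i) :
    semilocRed S κ θ' P w n (k + 1) i (semilocIncl S κ θ' P w n (k + 1) i y) = semilocIncl S κ θ' P w n k i (semilocRed S κ θ' P w n k i y) := by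
  unfold semilocRed semilocIncl semilocCoeff
  rw [← semilocH_comp_apply S κ θ' P w _ _ (coindFinMap (coeffHomK S θ' P (oMuIncl S (k + 1)) (oMuIncl_muTwistO S θ' (k + 1))) (κ.layerSubgroup n) ≫
      coindFinMap (coeffHomK S θ' P (oMuRed S (k + 1)) (oMuRed_muTwistO S θ' (k + 1))) (κ.layerSubgroup n)) (fun _ ↦ rfl)]
  exact semilocH_comp_apply S κ θ' P w _ _ _ (fun φ ↦ funext fun y ↦ Subtype.ext
    (oMuRed_oMuIncl_succ S (k := k) ((φ y : (coeffRepK S θ' P (k + 1)).toTopRep) : OMuCarrier K S (p ^ (k + 1))))) i y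

/-- `semilocScalar (m : 𝒪) = m • id` (the scalar action is a ring action). [cite: JohnsonLeungKings2011, §4.1 Def. 4.1] -/
theorem semilocScalar_natCast (n k i m : ℕ) (x : semilocCoh S κ θ' P w n k i) : semilocScalar S κ θ' P w n k i (m : padicCoeffIntegers S) x = m • x := by
  change (semilocScalarRingHom S κ θ' P w n k i (m : padicCoeffIntegers S)) x = m • x
  rw [map_natCast, AddMonoid.End.natCast_apply]

/-- ★★ **(E2) `p • z = incl (red z)`** on `Lloc_w(n,k+1)` (`incl ∘ red = p ⊗ id` on the carriers, pushed through `H^i(res_w, Maps(·))`). [cite: NeukirchSchmidtWingberg2008, (7.1.4)]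
[cite: Kato2004Asterisque, §8.2 (p. 180)] -/
theorem nsmul_eq_semilocIncl_semilocRed (n k i : ℕ) (z : semilocCoh S κ θ' P w n (k + 1) i) :
    p • z = semilocIncl S κ θ' P w n k i (semilocRed S κ θ' P w n k i z) := by
  rw [← semilocScalar_natCast S κ θ' P w n (k + 1) i p z]
  unfold semilocScalar semilocRed semilocIncl semilocCoeff
  exact semilocH_comp_apply S κ θ' P w _ _ _ (fun φ ↦ funext fun y ↦ Subtype.ext
    ((oMuIncl_oMuRed S k ((φ y : (coeffRepK S θ' P (k + 1)).toTopRep) : OMuCarrier K S (p ^ (k + 1)))).symm)) i z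

end Levels

end Summit.BirchSwinnertonDyer.BirchSwinnertonDyer.Theorems.SmallImageRttD2Seq

end
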